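import Summits.Schanuel.Schanuel.Theses.DiophantineDichotomy

/-!
# `EPiSimultaneousType`: the height clause is load-bearing, and the degree exponent cannot be negative
(negative lemmas for crux `stmt-Schanuel-6118`, route DiophantineDichotomy)

Two unconditional constraints on the crux
`Summit.Schanuel.Schanuel.Theses.DiophantineDichotomy.EPiSimultaneousType`
(`∃ a < 1, b, C > 0`, `max(|γ₁ − π|, |γ₂ − e|) ≥ exp(−C(dᵃ log H + dᵇ))` for admissible
`(d, H, γ)`), both witnessed by RATIONAL points (`[ℚ(γ):ℚ] = 1`, explicit polynomial `N·X − p`):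

* `epiSimultaneousType_false_without_heightClause` — with the integer-polynomial clause deleted
  (only `[ℚ(γ):ℚ] ≤ d` kept) the measure is false for EVERY `(a, b, C)`: `H` decouples from `γ`,
  and `d = 1, H = 0` (`Real.log 0 = 0`) leave the bound `exp(−C)`, beaten by a rational point.
* `epiSimultaneousType_false_with_neg_exponent` — the strengthening `a < 0` of the crux is false:
  at a level `d` with `C dᵃ ≤ 1/2` the floor approximants `(⌊πN⌋/N, ⌊eN⌋/N)` (height `4N`,
  distance `≤ 1/N`) beat `exp(−C(dᵃ log 4N + dᵇ)) ≥ (4N)^{−1/2} e^{−Cdᵇ}` for `N > 4e^{2Cdᵇ}`.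

Everything is proved (no named facts); cdisprove seat, Disproof.lean §1–§2.
-/

set_option linter.dupNamespace false

noncomputable section

namespace Summit.Schanuel.Schanuel.Theorems

open Polynomial

namespace EPiSimultaneousType

/-- Sup norm on `Fin 2 → ℂ`. [folklore] -/
theorem norm_sub_eq_max (γ ϑ : Fin 2 → ℂ) : ‖γ - ϑ‖ = max ‖γ 0 - ϑ 0‖ ‖γ 1 - ϑ 1‖ := by
  rw [Pi.norm_def]
  simp [Fin.univ_succ]

/-- `[ℚ(γ):ℚ] = 1` for a rational point (`ℚ(γ) = ⊥`). [folklore] -/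
theorem finrank_adjoin_ratCast (q : Fin 2 → ℚ) :
    Module.finrank ℚ ↥(IntermediateField.adjoin ℚ (Set.range fun i => ((q i : ℚ) : ℂ))) = 1 := by
  have h : IntermediateField.adjoin ℚ (Set.range fun i => ((q i : ℚ) : ℂ)) = ⊥ := by
    rw [← le_bot_iff, IntermediateField.adjoin_le_iff]
    rintro _ ⟨i, rfl⟩
    rw [SetLike.mem_coe, IntermediateField.mem_bot]
    exact ⟨q i, by simp⟩
  rw [h, IntermediateField.finrank_bot]

/-- The clause for a fraction `p / N`: `N·X − p` is non-zero of degree `1`, height `max(|p|, N)`.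
[folklore] -/
theorem clause_of_eq_div {z : ℂ} {p : ℤ} {N d H : ℕ} (hN : 1 ≤ N) (hd : 1 ≤ d)
    (hp : |p| ≤ (H : ℤ)) (hNH : N ≤ H) (hz : z = (p : ℂ) / (N : ℂ)) :
    ∃ P : Polynomial ℤ, P ≠ 0 ∧ P.natDegree ≤ d ∧ (∀ k, |P.coeff k| ≤ (H : ℤ)) ∧
      Polynomial.aeval z P = 0 := by
  refine ⟨C (N : ℤ) * X + C (-p), ?_, (Polynomial.natDegree_linear_le).trans hd, ?_, ?_⟩
  · intro h
    have := congrArg (fun P : Polynomial ℤ => P.coeff 1) h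
    simp only [coeff_add, coeff_C_mul, coeff_X, coeff_C, coeff_zero] at this
    norm_num at this
    omega
  · intro k
    rcases k with _ | _ | k
    · simp only [coeff_add, coeff_C_mul, coeff_X, coeff_C]
      norm_num
      exact hp
    · simp only [coeff_add, coeff_C_mul, coeff_X, coeff_C]
      norm_num
      exact_mod_cast hNH
    · simp only [coeff_add, coeff_C_mul, coeff_X, coeff_C]
      norm_num
  · have hN0 : (N : ℂ) ≠ 0 := by exact_mod_cast (show N ≠ 0 by omega)
    simp [hz, mul_div_cancel₀ _ hN0]

/-- `|⌊xN⌋/N − x| ≤ 1/N`. [folklore] -/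
theorem abs_floor_div_sub_le (x : ℝ) {N : ℕ} (hN : 1 ≤ N) :
    |((((⌊x * N⌋ : ℤ) : ℚ) / (N : ℚ) : ℚ) : ℝ) - x| ≤ 1 / N := by
  have hN0 : (0 : ℝ) < N := by exact_mod_cast hN
  have h1 : ((((⌊x * N⌋ : ℤ) : ℚ) / (N : ℚ) : ℚ) : ℝ) = (⌊x * N⌋ : ℝ) / N := by simp
  rw [h1]
  have hfl := Int.floor_le (x * N)
  have hlt := Int.lt_floor_add_one (x * N)
  have e : (⌊x * N⌋ : ℝ) / N - x = -((x * N - ⌊x * N⌋) / N) := by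
    field_simp
    ring
  rw [e, abs_neg, abs_of_nonneg (div_nonneg (by linarith) hN0.le)]
  exact div_le_div_of_nonneg_right (by linarith) hN0.le

/-- The clause for the floor approximant `⌊xN⌋/N` of `x ∈ [0, 4)` at any level `d ≥ 1` and any
height `H ≥ 4N`. [folklore] -/
theorem clause_floor {x : ℝ} (hx0 : 0 ≤ x) (hx4 : x < 4) {N d H : ℕ} (hN : 1 ≤ N) (hd : 1 ≤ d)
    (hH : 4 * N ≤ H) :
    ∃ P : Polynomial ℤ, P ≠ 0 ∧ P.natDegree ≤ d ∧ (∀ k, |P.coeff k| ≤ (H : ℤ)) ∧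
      Polynomial.aeval (((((⌊x * N⌋ : ℤ) : ℚ) / (N : ℚ) : ℚ) : ℂ)) P = 0 := by
  have hNH : N ≤ H := by omega
  refine clause_of_eq_div (p := ⌊x * N⌋) hN hd ?_ hNH (by simp)
  have hlo : (0 : ℤ) ≤ ⌊x * N⌋ := Int.floor_nonneg.mpr (by positivity)
  have hN0' : (0 : ℝ) < N := by exact_mod_cast hN
  have hhi : ⌊x * N⌋ < 4 * (N : ℤ) := by
    rw [Int.floor_lt]
    push_cast
    exact mul_lt_mul_of_pos_right hx4 hN0'
  rw [abs_of_nonneg hlo]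
  have : (4 * N : ℕ) ≤ (H : ℤ) := by exact_mod_cast hH
  push_cast at this
  omega

end EPiSimultaneousType

open EPiSimultaneousType

/-- **The integer-polynomial (height) clause of `EPiSimultaneousType` is load-bearing**: the
measure with that clause deleted — only `[ℚ(γ):ℚ] ≤ d` kept, everything else verbatim — is false
for EVERY `(a, b, C)`: at `d = 1`, `H = 0` the bound is `exp(−C) > 0` and rational points are
dense. [folklore] -/
theorem epiSimultaneousType_false_without_heightClause (a b C : ℝ) :
    ¬ (∀ (d H : ℕ) (γ : Fin 2 → ℂ), Module.finrank ℚ ↥(IntermediateField.adjoin ℚ (Set.range γ)) ≤ d →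
      Real.exp (-(C * ((d : ℝ) ^ a * Real.log H + (d : ℝ) ^ b))) ≤
        ‖γ - ![(Real.pi : ℂ), (Real.exp 1 : ℂ)]‖) := by
  intro h
  set ε : ℝ := Real.exp (-C) with hε
  have hε0 : 0 < ε := Real.exp_pos _
  obtain ⟨q₁, hq₁, hq₁'⟩ := exists_rat_btwn (show Real.pi - ε < Real.pi by linarith)
  obtain ⟨q₂, hq₂, hq₂'⟩ := exists_rat_btwn (show Real.exp 1 - ε < Real.exp 1 by linarith)
  have h1 := h 1 0 (fun i => ((![q₁, q₂] i : ℚ) : ℂ)) (finrank_adjoin_ratCast ![q₁, q₂]).le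
  have hb : Real.exp (-(C * (((1 : ℕ) : ℝ) ^ a * Real.log ((0 : ℕ) : ℝ) + ((1 : ℕ) : ℝ) ^ b))) = ε := by
    simp [hε]
  rw [hb, norm_sub_eq_max] at h1
  have e0 : ‖(fun i => ((![q₁, q₂] i : ℚ) : ℂ)) 0 - ![(Real.pi : ℂ), (Real.exp 1 : ℂ)] 0‖ =
      |(q₁ : ℝ) - Real.pi| := by
    simp only [Matrix.cons_val_zero]
    rw [← Complex.ofReal_ratCast, ← Complex.ofReal_sub, Complex.norm_real, Real.norm_eq_abs]
  have e1 : ‖(fun i => ((![q₁, q₂] i : ℚ) : ℂ)) 1 - ![(Real.pi : ℂ), (Real.exp 1 : ℂ)] 1‖ =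
      |(q₂ : ℝ) - Real.exp 1| := by
    simp only [Matrix.cons_val_one, Matrix.cons_val_zero]
    rw [← Complex.ofReal_ratCast, ← Complex.ofReal_sub, Complex.norm_real, Real.norm_eq_abs]
  rw [e0, e1] at h1
  have a0 : |(q₁ : ℝ) - Real.pi| < ε := by rw [abs_lt]; constructor <;> linarith
  have a1 : |(q₂ : ℝ) - Real.exp 1| < ε := by rw [abs_lt]; constructor <;> linarith
  have := max_lt a0 a1
  linarith

/-- **The degree exponent of `EPiSimultaneousType` cannot be negative**: the crux with `a < 1`
strengthened to `a < 0` (everything else verbatim) is FALSE. For `a < 0`, `C dᵃ → 0`; at a level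
`d` with `C dᵃ ≤ 1/2` the floor approximants `(⌊πN⌋/N, ⌊eN⌋/N)` (admissible: `[ℚ(γ):ℚ] = 1 ≤ d`,
polynomials `N·X − ⌊πN⌋`, `N·X − ⌊eN⌋` of degree `1 ≤ d` and height `≤ 4N`) lie within `1/N` of
`(π, e)`, while the bound is `≥ (4N)^{−1/2} e^{−C dᵇ} > 1/N` for `N > 4 e^{2Cdᵇ}`. [folklore] -/
theorem epiSimultaneousType_false_with_neg_exponent :
    ¬ ∃ a b C : ℝ, a < 0 ∧ 0 < C ∧ ∀ (d H : ℕ) (γ : Fin 2 → ℂ),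
      Module.finrank ℚ ↥(IntermediateField.adjoin ℚ (Set.range γ)) ≤ d →
      (∀ i, ∃ P : Polynomial ℤ, P ≠ 0 ∧ P.natDegree ≤ d ∧ (∀ k, |P.coeff k| ≤ (H : ℤ)) ∧
        Polynomial.aeval (γ i) P = 0) →
      Real.exp (-(C * ((d : ℝ) ^ a * Real.log H + (d : ℝ) ^ b))) ≤
        ‖γ - ![(Real.pi : ℂ), (Real.exp 1 : ℂ)]‖ := by
  rintro ⟨a, b, C, ha, hC, hM⟩
  -- a level `d` with `C d^a ≤ 1/2`
  have ht : Filter.Tendsto (fun x : ℝ => C * x ^ a) Filter.atTop (nhds 0) := by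
    have := (tendsto_rpow_neg_atTop (show 0 < -a by linarith)).const_mul C
    simpa using this
  have hev : ∀ᶠ n : ℕ in Filter.atTop, C * (n : ℝ) ^ a ≤ 1 / 2 :=
    (ht.comp tendsto_natCast_atTop_atTop).eventually (ge_mem_nhds (by norm_num))
  obtain ⟨d, hd1, hda⟩ := ((Filter.eventually_ge_atTop 1).and hev).exists
  -- a large denominator
  obtain ⟨N, hN⟩ := exists_nat_gt (4 * Real.exp (2 * C * (d : ℝ) ^ b))
  have hNpos : (0 : ℝ) < N := lt_trans (by positivity) hN
  have hN1 : 1 ≤ N := by exact_mod_cast hNpos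
  -- the floor approximant
  set q : Fin 2 → ℚ := ![((⌊Real.pi * N⌋ : ℤ) : ℚ) / (N : ℚ), ((⌊Real.exp 1 * N⌋ : ℤ) : ℚ) / (N : ℚ)]
    with hq
  set γ : Fin 2 → ℂ := fun i => ((q i : ℚ) : ℂ) with hγ
  have he4 : Real.exp 1 < 4 := by
    have := Real.exp_one_lt_d9; norm_num at this; linarith
  have hadm : ∀ i, ∃ P : Polynomial ℤ, P ≠ 0 ∧ P.natDegree ≤ d ∧
      (∀ k, |P.coeff k| ≤ ((4 * N : ℕ) : ℤ)) ∧ Polynomial.aeval (γ i) P = 0 := by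
    intro i
    fin_cases i
    · simpa [hγ, hq] using clause_floor Real.pi_pos.le Real.pi_lt_four hN1 hd1 (le_refl (4 * N))
    · simpa [hγ, hq] using
        clause_floor (Real.exp_pos 1).le he4 hN1 hd1 (le_refl (4 * N))
  have h1 := hM d (4 * N) γ ((finrank_adjoin_ratCast q).le.trans hd1) hadm
  -- distance ≤ 1/N
  have h2 : ‖γ - ![(Real.pi : ℂ), (Real.exp 1 : ℂ)]‖ ≤ 1 / N := by
    rw [norm_sub_eq_max]
    have e0 : ‖γ 0 - ![(Real.pi : ℂ), (Real.exp 1 : ℂ)] 0‖ =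
        |((((⌊Real.pi * N⌋ : ℤ) : ℚ) / (N : ℚ) : ℚ) : ℝ) - Real.pi| := by
      simp only [hγ, hq, Matrix.cons_val_zero]
      rw [← Complex.ofReal_ratCast, ← Complex.ofReal_sub, Complex.norm_real, Real.norm_eq_abs]
    have e1 : ‖γ 1 - ![(Real.pi : ℂ), (Real.exp 1 : ℂ)] 1‖ =
        |((((⌊Real.exp 1 * N⌋ : ℤ) : ℚ) / (N : ℚ) : ℚ) : ℝ) - Real.exp 1| := by
      simp only [hγ, hq, Matrix.cons_val_one, Matrix.cons_val_zero]
      rw [← Complex.ofReal_ratCast, ← Complex.ofReal_sub, Complex.norm_real, Real.norm_eq_abs]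
    rw [e0, e1]
    exact max_le (abs_floor_div_sub_le _ hN1) (abs_floor_div_sub_le _ hN1)
  -- the bound is > 1/N
  have h3 : (1 : ℝ) / N <
      Real.exp (-(C * ((d : ℝ) ^ a * Real.log ((4 * N : ℕ) : ℝ) + (d : ℝ) ^ b))) := by
    have hlog4N : 0 ≤ Real.log (4 * N : ℕ) := Real.log_natCast_nonneg _
    have hda0 : 0 ≤ C * (d : ℝ) ^ a := by positivity
    have hlogN : Real.log 4 + 2 * C * (d : ℝ) ^ b < Real.log N := by
      rw [← Real.exp_lt_exp, Real.exp_add, Real.exp_log (by norm_num), Real.exp_log hNpos]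
      exact hN
    have hsplit : Real.log (4 * N : ℕ) = Real.log 4 + Real.log N := by
      push_cast
      rw [Real.log_mul (by norm_num) hNpos.ne']
    have hrew : (1 : ℝ) / N = Real.exp (-Real.log N) := by
      rw [Real.exp_neg, Real.exp_log hNpos, one_div]
    rw [hrew, Real.exp_lt_exp, neg_lt_neg_iff]
    calc C * ((d : ℝ) ^ a * Real.log (4 * N : ℕ) + (d : ℝ) ^ b)
        = C * (d : ℝ) ^ a * Real.log (4 * N : ℕ) + C * (d : ℝ) ^ b := by ring
      _ ≤ 1 / 2 * Real.log (4 * N : ℕ) + C * (d : ℝ) ^ b := by gcongr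
      _ = 1 / 2 * (Real.log 4 + Real.log N) + C * (d : ℝ) ^ b := by rw [hsplit]
      _ < Real.log N := by linarith
  linarith

end Summit.Schanuel.Schanuel.Theorems

end
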